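import Mathlib
import HarnessLib
import Summits.Ventures.LatticeQCDFlow.Scaling.ChiSqContraction
import Summits.Ventures.LatticeQCDFlow.Scaling.HypercontractiveDeviation

/-!
# TensorKernels — independent blocks: the product law `π₁ ⊗ π₂`, the product layer
# `K₁ ⊗ K₂`, and THE `χ²` GAP OF A PRODUCT LAYER IS THE WORSE FACTOR'S
# (`L2Contracts (K₁ ⊗ K₂) (π₁ ⊗ π₂) (max λ₁ λ₂)`) — the dimension-free half of the relaxation
# hypotheses of this row's switching laws

HONEST FRAMING: exact (Metropolis-corrected) sampling algorithms for lattice gauge theory;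
figures of merit are autocorrelation/cost numbers at stated couplings and volumes; no
continuum-physics claim.

Venture `LatticeQCDFlow` (cell pub-lqcd), topic `Scaling`; FANOUT row 19 (`su2-snf`, GEN-11).
OUR WORK (elementary finite sums on a product of two finite types), nothing here is cited as a
fact (the `ANOVA` / Efron–Stein split of a measure on a product into its first-block average
and a fibrewise zero-mass remainder is folklore).  Vocabulary: the Literature's `stepLaw K μ = μK`, `IsStationary π K`, `IsRowStochastic K`, and this row's
`ChiSqContracts` (`Scaling/ChiSqContraction`), `sq_sum_mul_mul_le` (Cauchy–Schwarz in `L²(π)`,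
`Scaling/HypercontractiveDeviation`).  MODEL-FREE.

WHY.  Every certified switching law of this row (`χ²` route GEN-5/6, hypercontractive route
GEN-10) takes ONE relaxation constant of the between-switch layer as input — the zero-mass
`L²(1/π)` contraction `λ` (`= λ⋆` for reversible layers), on the hypercontractive route composed
with a full `L²(1/π) → L⁴(π)` bound (`HyperContracts.of_comp`).  Is the constant of the whole
lattice the constant of one block?  Answered here for EXACTLY independent blocks.

* §1 `tensorLaw`, `tensorKernel`: positivity, total mass, row sums, row-stochasticity,
  stationarity of the product (`isStationary_tensor`), the product of composed layers is the
  composition of the products (`tensorKernel_comp`), and the two iterated forms of one step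
  (`stepLaw_tensorKernel`, `stepLaw_tensorKernel'`: update block 1 inside, block 2 outside, or
  the reverse).
* §2 `sum_stepLaw_sq_div_le`: a row-stochastic `π`-stationary layer never expands `L²(1/π)`
  (`Σ_y (ζK)(y)²/π(y) ≤ Σ_x ζ(x)²/π(x)` for EVERY `ζ`, Cauchy–Schwarz column by column) — the
  full-space companion (constant `1`) of the zero-mass contraction.
* §3 **`L2Contracts K π λ`** (`Σ_y (ξK)(y)²/π(y) ≤ λ²·Σ_x ξ(x)²/π(x)` on ZERO-MASS `ξ` — the
  hypothesis shape of `HyperContracts.comp` / `.of_comp` and of the `χ²` route), its bridge from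
  `ChiSqContracts` (`L2Contracts.of_chiSqContracts`), the endpoints `λ = 1` (every stochastic
  stationary layer) and `λ = 0` (perfect relaxation), and **`L2Contracts.tensor`**: if block `i`
  contracts with `λᵢ ≥ 0` (block 1 `π₁`-stationary with unit row sums, block 2 row-stochastic and
  `π₂`-stationary, `π₁, π₂` positive, `Σ π₁ = 1`) then the product layer contracts zero-mass
  deviations on the product with `max λ₁ λ₂` — NOT `λ₁λ₂` and NOT degrading with the number of
  blocks.  Proof: split `ξ = π₁ ⊗ m + ξᵇ` with `m(x₂) = Σ_{x₁} ξ(x₁,x₂)` (zero-mass) and `ξᵇ(·,x₂)`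
  zero-mass for every `x₂`; the two parts stay `L²(1/π)`-orthogonal after the step, the first
  moves only under `K₂` (factor `λ₂`), the second contracts under `K₁` fibrewise (factor `λ₁`)
  and does not expand under `K₂` (§2).

NOT CLAIMED: interacting blocks (the row's lattice layers are NOT exact products); `N`-fold
products (iterate the binary statement along `X₁ × (X₂ × ⋯)`).
-/

namespace Summit.Ventures.LatticeQCDFlow.Scaling

open Finset
open Literature.Probability.MarkovChains (stepLaw IsStationary IsRowStochastic)
open Literature.Probability.ImportanceSampling (chiSqDiv chiSqDiv_eq_sum_sq_div)

variable {X Y : Type*} [Fintype X] [Fintype Y]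

/-! ## §1 Product laws and product layers -/

/-- The product law `(π₁ ⊗ π₂)(x₁,x₂) = π₁(x₁)·π₂(x₂)` of two independent blocks. -/
def tensorLaw (π₁ : X → ℝ) (π₂ : Y → ℝ) : X × Y → ℝ := fun z => π₁ z.1 * π₂ z.2

/-- The product layer `(K₁ ⊗ K₂)((x₁,x₂),(y₁,y₂)) = K₁(x₁,y₁)·K₂(x₂,y₂)`: the two blocks are
updated independently, each by its own kernel. -/
def tensorKernel (K₁ : X → X → ℝ) (K₂ : Y → Y → ℝ) : X × Y → X × Y → ℝ :=
  fun z w => K₁ z.1 w.1 * K₂ z.2 w.2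

omit [Fintype X] [Fintype Y] in
/-- Unfolding lemma for `tensorLaw`. -/
@[simp] theorem tensorLaw_apply (π₁ : X → ℝ) (π₂ : Y → ℝ) (z : X × Y) :
    tensorLaw π₁ π₂ z = π₁ z.1 * π₂ z.2 := rfl

omit [Fintype X] [Fintype Y] in
/-- Unfolding lemma for `tensorKernel`. -/
@[simp] theorem tensorKernel_apply (K₁ : X → X → ℝ) (K₂ : Y → Y → ℝ) (z w : X × Y) :
    tensorKernel K₁ K₂ z w = K₁ z.1 w.1 * K₂ z.2 w.2 := rfl

omit [Fintype X] [Fintype Y] in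
/-- `tensorLaw` on an explicit pair. -/
@[simp] theorem tensorLaw_mk (π₁ : X → ℝ) (π₂ : Y → ℝ) (x : X) (y : Y) :
    tensorLaw π₁ π₂ (x, y) = π₁ x * π₂ y := rfl

omit [Fintype X] [Fintype Y] in
/-- The product of positive laws is positive. -/
theorem tensorLaw_pos {π₁ : X → ℝ} {π₂ : Y → ℝ} (h₁ : ∀ x, 0 < π₁ x) (h₂ : ∀ y, 0 < π₂ y) :
    ∀ z, 0 < tensorLaw π₁ π₂ z := fun z => mul_pos (h₁ z.1) (h₂ z.2)

/-- Total mass of the product law: `Σ (π₁ ⊗ π₂) = (Σ π₁)·(Σ π₂)`. -/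
theorem sum_tensorLaw (π₁ : X → ℝ) (π₂ : Y → ℝ) :
    ∑ z, tensorLaw π₁ π₂ z = (∑ x, π₁ x) * ∑ y, π₂ y := by
  rw [Fintype.sum_prod_type, sum_mul_sum]
  rfl

/-- The product of two probability vectors is a probability vector. -/
theorem sum_tensorLaw_eq_one {π₁ : X → ℝ} {π₂ : Y → ℝ} (h₁ : ∑ x, π₁ x = 1)
    (h₂ : ∑ y, π₂ y = 1) : ∑ z, tensorLaw π₁ π₂ z = 1 := by
  rw [sum_tensorLaw, h₁, h₂, one_mul]

/-- Row sums of the product layer multiply. -/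
theorem sum_tensorKernel (K₁ : X → X → ℝ) (K₂ : Y → Y → ℝ) (z : X × Y) :
    ∑ w, tensorKernel K₁ K₂ z w = (∑ x, K₁ z.1 x) * ∑ y, K₂ z.2 y := by
  rw [Fintype.sum_prod_type, sum_mul_sum]
  rfl

/-- Unit row sums are inherited by the product layer. -/
theorem sum_tensorKernel_eq_one {K₁ : X → X → ℝ} {K₂ : Y → Y → ℝ} (h₁ : ∀ x, ∑ x', K₁ x x' = 1)
    (h₂ : ∀ y, ∑ y', K₂ y y' = 1) : ∀ z, ∑ w, tensorKernel K₁ K₂ z w = 1 := fun z => by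
  rw [sum_tensorKernel, h₁, h₂, one_mul]

/-- The product of row-stochastic layers is row-stochastic. -/
theorem isRowStochastic_tensor {K₁ : X → X → ℝ} {K₂ : Y → Y → ℝ} (h₁ : IsRowStochastic K₁)
    (h₂ : IsRowStochastic K₂) : IsRowStochastic (tensorKernel K₁ K₂) :=
  ⟨fun z w => mul_nonneg (h₁.1 z.1 w.1) (h₂.1 z.2 w.2), sum_tensorKernel_eq_one h₁.2 h₂.2⟩

/-- **One step of the product layer, block 1 inside**: apply `K₁` to every `x₂`-fibre of `ξ`,
then `K₂` across the fibres — `(ξ(K₁⊗K₂))(y₁,y₂) = Σ_{x₂} (ξ(·,x₂)K₁)(y₁)·K₂(x₂,y₂)`. -/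
theorem stepLaw_tensorKernel (K₁ : X → X → ℝ) (K₂ : Y → Y → ℝ) (ξ : X × Y → ℝ) (w : X × Y) :
    stepLaw (tensorKernel K₁ K₂) ξ w = ∑ y, stepLaw K₁ (fun x => ξ (x, y)) w.1 * K₂ y w.2 := by
  unfold stepLaw
  rw [Fintype.sum_prod_type, sum_comm]
  refine sum_congr rfl fun y _ => ?_
  rw [sum_mul]
  exact sum_congr rfl fun x _ => by simp only [tensorKernel_apply]; ring

/-- **One step of the product layer, block 2 inside**:
`(ξ(K₁⊗K₂))(y₁,y₂) = Σ_{x₁} (ξ(x₁,·)K₂)(y₂)·K₁(x₁,y₁)`. -/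
theorem stepLaw_tensorKernel' (K₁ : X → X → ℝ) (K₂ : Y → Y → ℝ) (ξ : X × Y → ℝ) (w : X × Y) :
    stepLaw (tensorKernel K₁ K₂) ξ w = ∑ x, stepLaw K₂ (fun y => ξ (x, y)) w.2 * K₁ x w.1 := by
  unfold stepLaw
  rw [Fintype.sum_prod_type]
  refine sum_congr rfl fun x _ => ?_
  rw [sum_mul]
  exact sum_congr rfl fun y _ => by simp only [tensorKernel_apply]; ring

/-- **The product of stationary laws is stationary for the product layer.** -/
theorem isStationary_tensor {K₁ : X → X → ℝ} {K₂ : Y → Y → ℝ} {π₁ : X → ℝ} {π₂ : Y → ℝ}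
    (h₁ : IsStationary π₁ K₁) (h₂ : IsStationary π₂ K₂) :
    IsStationary (tensorLaw π₁ π₂) (tensorKernel K₁ K₂) := by
  intro w
  have e : ∑ z, tensorLaw π₁ π₂ z * tensorKernel K₁ K₂ z w
      = stepLaw (tensorKernel K₁ K₂) (tensorLaw π₁ π₂) w := rfl
  rw [e, stepLaw_tensorKernel]
  have e1 : ∀ y, stepLaw K₁ (fun x => tensorLaw π₁ π₂ (x, y)) w.1 = π₂ y * π₁ w.1 := by
    intro y
    unfold stepLaw
    simp only [tensorLaw_apply]
    rw [show ∑ x, π₁ x * π₂ y * K₁ x w.1 = π₂ y * ∑ x, π₁ x * K₁ x w.1 by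
      rw [mul_sum]; exact sum_congr rfl fun x _ => by ring, h₁ w.1]
  simp_rw [e1]
  rw [show ∑ y, π₂ y * π₁ w.1 * K₂ y w.2 = π₁ w.1 * ∑ y, π₂ y * K₂ y w.2 by
    rw [mul_sum]; exact sum_congr rfl fun y _ => by ring, h₂ w.2]
  rfl

/-- **Composition commutes with the product**: the layer "`A₁ ⊗ A₂` then `B₁ ⊗ B₂`" is the
product of the layers "`A₁` then `B₁`" and "`A₂` then `B₂`". -/
theorem tensorKernel_comp (A₁ B₁ : X → X → ℝ) (A₂ B₂ : Y → Y → ℝ) :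
    (fun z w => ∑ v, tensorKernel A₁ A₂ z v * tensorKernel B₁ B₂ v w)
      = tensorKernel (fun x x' => ∑ u, A₁ x u * B₁ u x') (fun y y' => ∑ u, A₂ y u * B₂ u y') := by
  funext z w
  simp only [tensorKernel_apply]
  rw [Fintype.sum_prod_type, sum_mul_sum]
  exact sum_congr rfl fun u _ => sum_congr rfl fun u' _ => by ring

/-! ## §2 A stochastic stationary layer never expands `L²(1/π)` -/

/-- **Full-space contraction with constant `1`.**  For a row-stochastic `π`-stationary layer
(`π > 0`) and EVERY signed `ζ`: `Σ_y (ζK)(y)²/π(y) ≤ Σ_x ζ(x)²/π(x)`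
(Cauchy–Schwarz in each column `y` with weights `π(x)K(x,y)`, then `Σ_y K(x,y) = 1`). -/
theorem sum_stepLaw_sq_div_le {K : X → X → ℝ} {π : X → ℝ} (hπ : ∀ x, 0 < π x)
    (hK : IsRowStochastic K) (hst : IsStationary π K) (ζ : X → ℝ) :
    ∑ y, stepLaw K ζ y ^ 2 / π y ≤ ∑ x, ζ x ^ 2 / π x := by
  -- column-wise Cauchy–Schwarz: (ζK)(y)² ≤ (Σ_x K(x,y) ζ(x)²/π(x)) · π(y)
  have hcol : ∀ y, stepLaw K ζ y ^ 2 / π y ≤ ∑ x, K x y * (ζ x ^ 2 / π x) := by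
    intro y
    have hw : ∀ x, 0 ≤ π x * K x y := fun x => mul_nonneg (hπ x).le (hK.1 x y)
    have hcs := sq_sum_mul_mul_le hw (fun x => ζ x / π x) (fun _ => (1:ℝ))
    have e1 : ∑ x, π x * K x y * (ζ x / π x) * 1 = stepLaw K ζ y := by
      unfold stepLaw
      exact sum_congr rfl fun x _ => by field_simp [(hπ x).ne']
    have e2 : ∑ x, π x * K x y * (ζ x / π x) ^ 2 = ∑ x, K x y * (ζ x ^ 2 / π x) :=
      sum_congr rfl fun x _ => by field_simp [(hπ x).ne']
    have e3 : ∑ x, π x * K x y * (1:ℝ) ^ 2 = π y := by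
      simp only [one_pow, mul_one]; exact hst y
    rw [e1, e2, e3] at hcs
    rw [div_le_iff₀ (hπ y), sq]
    simpa [sq] using hcs
  refine (sum_le_sum fun y _ => hcol y).trans (le_of_eq ?_)
  rw [sum_comm]
  exact sum_congr rfl fun x _ => by rw [← sum_mul, hK.2 x, one_mul]

/-! ## §3 Zero-mass `L²(1/π)` contraction and its tensorisation -/

/-- **`L2Contracts K π λ`** — the layer contracts ZERO-MASS deviations in `L²(1/π)` by `λ`:
`Σ_y (ξK)(y)²/π(y) ≤ λ²·Σ_x ξ(x)²/π(x)` whenever `Σ ξ = 0` (the hypothesis shape of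
`HyperContracts.comp` / `HyperContracts.of_comp`; for a `π`-stationary unit-row-sum layer it is
`ChiSqContracts K π λ`, `L2Contracts.of_chiSqContracts`). -/
def L2Contracts (K : X → X → ℝ) (π : X → ℝ) (lam : ℝ) : Prop :=
  ∀ ξ : X → ℝ, ∑ x, ξ x = 0 → ∑ y, stepLaw K ξ y ^ 2 / π y ≤ lam ^ 2 * ∑ x, ξ x ^ 2 / π x

/-- Monotonicity in the constant (`π > 0`, `0 ≤ λ ≤ λ'`). -/
theorem L2Contracts.mono {K : X → X → ℝ} {π : X → ℝ} {lam lam' : ℝ} (h : L2Contracts K π lam)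
    (hπ : ∀ x, 0 < π x) (hl : 0 ≤ lam) (hll : lam ≤ lam') : L2Contracts K π lam' :=
  fun ξ hξ => (h ξ hξ).trans (mul_le_mul_of_nonneg_right (pow_le_pow_left₀ hl hll 2)
    (sum_nonneg fun x _ => div_nonneg (sq_nonneg _) (hπ x).le))

/-- Endpoint `λ = 1`: EVERY row-stochastic `π`-stationary layer (`π > 0`) — §2. -/
theorem l2Contracts_one {K : X → X → ℝ} {π : X → ℝ} (hπ : ∀ x, 0 < π x) (hK : IsRowStochastic K)
    (hst : IsStationary π K) : L2Contracts K π 1 := fun ζ _ => by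
  rw [one_pow, one_mul]; exact sum_stepLaw_sq_div_le hπ hK hst ζ

/-- Endpoint `λ = 0`: PERFECT RELAXATION `K(x,·) = π` kills every zero-mass input. -/
theorem l2Contracts_perfect (π : X → ℝ) : L2Contracts (fun _ y => π y) π 0 := by
  intro ξ hξ
  have h0 : ∀ y, stepLaw (fun _ y => π y) ξ y = 0 := by
    intro y; unfold stepLaw; rw [← sum_mul, hξ, zero_mul]
  simp [h0]

/-- **Bridge from `ChiSqContracts`.**  For a `π`-stationary layer and a probability vector `π`,
`ChiSqContracts K π ρ` gives `L2Contracts K π ρ` (`ξ` zero-mass `⇒ μ = π + ξ` unit-mass with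
`μK − π = ξK`). -/
theorem L2Contracts.of_chiSqContracts {K : X → X → ℝ} {π : X → ℝ} {ρ : ℝ}
    (h : ChiSqContracts K π ρ) (hπ1 : ∑ x, π x = 1) (hst : IsStationary π K) :
    L2Contracts K π ρ := by
  intro ξ hξ
  have hμ1 : ∑ x, (π x + ξ x) = 1 := by rw [sum_add_distrib, hπ1, hξ, add_zero]
  have hstep : ∀ y, stepLaw K (fun x => π x + ξ x) y - π y = stepLaw K ξ y := by
    intro y
    unfold stepLaw
    simp_rw [add_mul, sum_add_distrib]
    rw [hst y]; ring
  have hc := h (fun x => π x + ξ x) hμ1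
  rw [chiSqDiv_eq_sum_sq_div, chiSqDiv_eq_sum_sq_div] at hc
  simp_rw [hstep] at hc
  simpa using hc

/-- `stepLaw` is additive in the input measure. -/
theorem stepLaw_add' (K : X → X → ℝ) (μ ν : X → ℝ) (y : X) :
    stepLaw K (fun x => μ x + ν x) y = stepLaw K μ y + stepLaw K ν y := by
  unfold stepLaw; rw [← sum_add_distrib]; exact sum_congr rfl fun x _ => by ring

/-- **THE `χ²` GAP OF A PRODUCT LAYER IS THE WORSE FACTOR'S.**  Block 1: `π₁ > 0` a probability
vector, `K₁` `π₁`-stationary with unit row sums, `L2Contracts K₁ π₁ λ₁`; block 2: `π₂ > 0`,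
`K₂` row-stochastic and `π₂`-stationary, `L2Contracts K₂ π₂ λ₂`; `λ₁, λ₂ ≥ 0`.  Then
`L2Contracts (K₁ ⊗ K₂) (π₁ ⊗ π₂) (max λ₁ λ₂)`. -/
theorem L2Contracts.tensor {K₁ : X → X → ℝ} {K₂ : Y → Y → ℝ} {π₁ : X → ℝ} {π₂ : Y → ℝ}
    {lam₁ lam₂ : ℝ} (hπ₁ : ∀ x, 0 < π₁ x) (hπ₁1 : ∑ x, π₁ x = 1) (hπ₂ : ∀ y, 0 < π₂ y)
    (hst₁ : IsStationary π₁ K₁) (hrow₁ : ∀ x, ∑ x', K₁ x x' = 1)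
    (hK₂ : IsRowStochastic K₂) (hst₂ : IsStationary π₂ K₂)
    (h₁ : L2Contracts K₁ π₁ lam₁) (h₂ : L2Contracts K₂ π₂ lam₂)
    (hl₁ : 0 ≤ lam₁) (hl₂ : 0 ≤ lam₂) :
    L2Contracts (tensorKernel K₁ K₂) (tensorLaw π₁ π₂) (max lam₁ lam₂) := by
  intro ξ hξ
  -- the first-block mass profile `m` and the split `ξ = π₁ ⊗ m + ξᵇ`
  set m : Y → ℝ := fun y => ∑ x, ξ (x, y) with hm_def
  have hm : ∑ y, m y = 0 := by
    rw [hm_def]; simp only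
    rw [← hξ, Fintype.sum_prod_type, sum_comm]
  set ξa : X × Y → ℝ := fun z => π₁ z.1 * m z.2 with hξa_def
  set ξb : X × Y → ℝ := fun z => ξ z - π₁ z.1 * m z.2 with hξb_def
  have hsplit : ∀ z, ξ z = ξa z + ξb z := fun z => by simp [hξa_def, hξb_def]
  have hb : ∀ y, ∑ x, ξb (x, y) = 0 := by
    intro y; simp only [hξb_def]
    rw [sum_sub_distrib, ← sum_mul, hπ₁1, one_mul]; exact sub_self _
  -- the two images
  set Sa : X × Y → ℝ := stepLaw (tensorKernel K₁ K₂) ξa with hSa_def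
  set Sb : X × Y → ℝ := stepLaw (tensorKernel K₁ K₂) ξb with hSb_def
  have hS : ∀ w, stepLaw (tensorKernel K₁ K₂) ξ w = Sa w + Sb w := by
    intro w
    rw [hSa_def, hSb_def, ← stepLaw_add']
    exact congrArg (fun f => stepLaw (tensorKernel K₁ K₂) f w) (funext hsplit)
  -- image of the averaged part: `π₁ ⊗ (m K₂)`
  have hSa : ∀ w, Sa w = π₁ w.1 * stepLaw K₂ m w.2 := by
    intro w
    rw [hSa_def, stepLaw_tensorKernel']
    have e : ∀ x, stepLaw K₂ (fun y => ξa (x, y)) w.2 = π₁ x * stepLaw K₂ m w.2 := by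
      intro x; unfold stepLaw; simp only [hξa_def]; rw [mul_sum]
      exact sum_congr rfl fun y _ => by ring
    simp_rw [e]
    rw [show ∑ x, π₁ x * stepLaw K₂ m w.2 * K₁ x w.1 = stepLaw K₂ m w.2 * ∑ x, π₁ x * K₁ x w.1
      by rw [mul_sum]; exact sum_congr rfl fun x _ => by ring, hst₁ w.1, mul_comm]
  -- image of the remainder: fibrewise `g(·, x₂) = ξᵇ(·,x₂)K₁`, then `K₂` across
  set g : X → Y → ℝ := fun x' y => stepLaw K₁ (fun x => ξb (x, y)) x' with hg_def
  have hSb : ∀ w, Sb w = stepLaw K₂ (g w.1) w.2 := by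
    intro w; rw [hSb_def, stepLaw_tensorKernel]; rfl
  have hg0 : ∀ y, ∑ x', g x' y = 0 := by
    intro y; simp only [hg_def]
    unfold stepLaw
    rw [sum_comm]
    simp_rw [← mul_sum, hrow₁, mul_one]
    exact hb y
  -- orthogonality of the two images in `L²(1/(π₁ ⊗ π₂))`
  have horth : ∑ w, Sa w * Sb w / tensorLaw π₁ π₂ w = 0 := by
    have e : ∀ w, Sa w * Sb w / tensorLaw π₁ π₂ w
        = stepLaw K₂ m w.2 / π₂ w.2 * stepLaw K₂ (g w.1) w.2 := by
      intro w; rw [hSa w, hSb w, tensorLaw_apply]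
      field_simp [(hπ₁ w.1).ne', (hπ₂ w.2).ne']
    simp_rw [e]
    rw [Fintype.sum_prod_type, sum_comm]
    refine sum_eq_zero fun y' _ => ?_
    dsimp only
    rw [← mul_sum]
    suffices h0 : ∑ x', stepLaw K₂ (g x') y' = 0 by rw [h0, mul_zero]
    unfold stepLaw
    rw [sum_comm]
    refine sum_eq_zero fun y _ => ?_
    rw [← sum_mul, hg0 y, zero_mul]
  -- orthogonality of the two parts of `ξ`
  have horth0 : ∑ z, ξa z * ξb z / tensorLaw π₁ π₂ z = 0 := by
    have e : ∀ z, ξa z * ξb z / tensorLaw π₁ π₂ z = m z.2 / π₂ z.2 * ξb z := by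
      intro z; simp only [hξa_def, tensorLaw_apply]
      field_simp [(hπ₁ z.1).ne', (hπ₂ z.2).ne']
    simp_rw [e]
    rw [Fintype.sum_prod_type, sum_comm]
    refine sum_eq_zero fun y _ => ?_
    dsimp only
    rw [← mul_sum, hb y, mul_zero]
  -- Pythagoras, twice
  have hPyS : ∑ w, stepLaw (tensorKernel K₁ K₂) ξ w ^ 2 / tensorLaw π₁ π₂ w
      = ∑ w, Sa w ^ 2 / tensorLaw π₁ π₂ w + ∑ w, Sb w ^ 2 / tensorLaw π₁ π₂ w := by
    have e : ∀ w, stepLaw (tensorKernel K₁ K₂) ξ w ^ 2 / tensorLaw π₁ π₂ w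
        = Sa w ^ 2 / tensorLaw π₁ π₂ w + Sb w ^ 2 / tensorLaw π₁ π₂ w
          + 2 * (Sa w * Sb w / tensorLaw π₁ π₂ w) := by
      intro w; rw [hS w]; ring
    simp_rw [e]
    rw [sum_add_distrib, sum_add_distrib, ← mul_sum, horth, mul_zero, add_zero]
  have hPyξ : ∑ z, ξ z ^ 2 / tensorLaw π₁ π₂ z
      = ∑ z, ξa z ^ 2 / tensorLaw π₁ π₂ z + ∑ z, ξb z ^ 2 / tensorLaw π₁ π₂ z := by
    have e : ∀ z, ξ z ^ 2 / tensorLaw π₁ π₂ z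
        = ξa z ^ 2 / tensorLaw π₁ π₂ z + ξb z ^ 2 / tensorLaw π₁ π₂ z
          + 2 * (ξa z * ξb z / tensorLaw π₁ π₂ z) := by
      intro z; rw [hsplit z]; ring
    simp_rw [e]
    rw [sum_add_distrib, sum_add_distrib, ← mul_sum, horth0, mul_zero, add_zero]
  -- the averaged part: norm `Σ m²/π₂`, image norm `Σ (mK₂)²/π₂ ≤ λ₂² Σ m²/π₂`
  have hNa0 : ∑ z, ξa z ^ 2 / tensorLaw π₁ π₂ z = ∑ y, m y ^ 2 / π₂ y := by
    have e : ∀ z, ξa z ^ 2 / tensorLaw π₁ π₂ z = π₁ z.1 * (m z.2 ^ 2 / π₂ z.2) := by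
      intro z; simp only [hξa_def, tensorLaw_apply]
      field_simp [(hπ₁ z.1).ne', (hπ₂ z.2).ne']
    simp_rw [e]
    rw [Fintype.sum_prod_type, sum_comm]
    dsimp only
    simp_rw [← sum_mul, hπ₁1, one_mul]
  have hNa : ∑ w, Sa w ^ 2 / tensorLaw π₁ π₂ w ≤ lam₂ ^ 2 * ∑ z, ξa z ^ 2 / tensorLaw π₁ π₂ z := by
    have e : ∀ w, Sa w ^ 2 / tensorLaw π₁ π₂ w = π₁ w.1 * (stepLaw K₂ m w.2 ^ 2 / π₂ w.2) := by
      intro w; rw [hSa w, tensorLaw_apply]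
      field_simp [(hπ₁ w.1).ne', (hπ₂ w.2).ne']
    simp_rw [e]
    rw [Fintype.sum_prod_type, sum_comm]
    dsimp only
    simp_rw [← sum_mul, hπ₁1, one_mul]
    rw [hNa0]
    exact h₂ m hm
  -- the remainder: `K₂` does not expand (§2), `K₁` contracts every fibre by `λ₁`
  have hNb : ∑ w, Sb w ^ 2 / tensorLaw π₁ π₂ w ≤ lam₁ ^ 2 * ∑ z, ξb z ^ 2 / tensorLaw π₁ π₂ z := by
    have e : ∀ w, Sb w ^ 2 / tensorLaw π₁ π₂ w
        = (1 / π₁ w.1) * (stepLaw K₂ (g w.1) w.2 ^ 2 / π₂ w.2) := by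
      intro w; rw [hSb w, tensorLaw_apply]
      field_simp [(hπ₁ w.1).ne', (hπ₂ w.2).ne']
    simp_rw [e]
    rw [Fintype.sum_prod_type]
    dsimp only
    simp_rw [← mul_sum]
    have eR : ∑ z, ξb z ^ 2 / tensorLaw π₁ π₂ z = ∑ y, ∑ x, ξb (x, y) ^ 2 / (π₁ x * π₂ y) := by
      rw [Fintype.sum_prod_type, sum_comm]; rfl
    calc ∑ x', 1 / π₁ x' * ∑ y', stepLaw K₂ (g x') y' ^ 2 / π₂ y'
        ≤ ∑ x', 1 / π₁ x' * ∑ y, g x' y ^ 2 / π₂ y :=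
          sum_le_sum fun x' _ => mul_le_mul_of_nonneg_left
            (sum_stepLaw_sq_div_le hπ₂ hK₂ hst₂ (g x')) (div_nonneg zero_le_one (hπ₁ x').le)
      _ = ∑ y, 1 / π₂ y * ∑ x', g x' y ^ 2 / π₁ x' := by
          simp_rw [mul_sum]
          rw [sum_comm]
          exact sum_congr rfl fun y _ => sum_congr rfl fun x' _ => by
            field_simp [(hπ₁ x').ne', (hπ₂ y).ne']
      _ ≤ ∑ y, 1 / π₂ y * (lam₁ ^ 2 * ∑ x, ξb (x, y) ^ 2 / π₁ x) :=
          sum_le_sum fun y _ => mul_le_mul_of_nonneg_left (h₁ _ (hb y))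
            (div_nonneg zero_le_one (hπ₂ y).le)
      _ = lam₁ ^ 2 * ∑ z, ξb z ^ 2 / tensorLaw π₁ π₂ z := by
          rw [eR, mul_sum]
          refine sum_congr rfl fun y _ => ?_
          rw [mul_left_comm]
          congr 1
          rw [mul_sum]
          refine sum_congr rfl fun x _ => ?_
          rw [div_mul_div_comm, one_mul, mul_comm (π₂ y) (π₁ x)]
  -- assemble
  have hA : 0 ≤ ∑ z, ξa z ^ 2 / tensorLaw π₁ π₂ z :=
    sum_nonneg fun z _ => div_nonneg (sq_nonneg _) (tensorLaw_pos hπ₁ hπ₂ z).le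
  have hB : 0 ≤ ∑ z, ξb z ^ 2 / tensorLaw π₁ π₂ z :=
    sum_nonneg fun z _ => div_nonneg (sq_nonneg _) (tensorLaw_pos hπ₁ hπ₂ z).le
  have hm1 : lam₁ ^ 2 ≤ (max lam₁ lam₂) ^ 2 := pow_le_pow_left₀ hl₁ (le_max_left _ _) 2
  have hm2 : lam₂ ^ 2 ≤ (max lam₁ lam₂) ^ 2 := pow_le_pow_left₀ hl₂ (le_max_right _ _) 2
  rw [hPyS, hPyξ, mul_add]
  exact add_le_add (hNa.trans (mul_le_mul_of_nonneg_right hm2 hA))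
    (hNb.trans (mul_le_mul_of_nonneg_right hm1 hB))

end Summit.Ventures.LatticeQCDFlow.Scaling
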